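import Summits.ResolutionOfSingularities.ResolutionOfSingularities.Theorems.FrobeniusLadderFRationalResolutionGaloisTwistChart
import Summits.ResolutionOfSingularities.ResolutionOfSingularities.Theorems.FrobeniusLadderFRationalResolutionGaloisFibre
import HarnessLib

/-!
# Crux `FrobeniusLadder.FRationalResolution` (stmt-ResolutionOfSingularities-15317), line `redirect`,
# stub `stub_diagonalizableQuotientResolution` — the Galois group acts TRANSITIVELY on the points of the chart
# `(B ⊗_K K') ⊗_B C` over a point of `C` (item [M] «transitivity of D on the fibre» of MEMO-15317-leafhand2-g14 §3)

Setting of the Galois route (`…GaloisTwistChart`, `…GaloisUpstairsPieceCover`): `K'/K` finite Galois, `B' = B ⊗_K K'` with its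
twists `1 ⊗ σ`, the chart `C` over `B` and its base change `C' = B' ⊗_B C` with the chart twists `σ'' = (1 ⊗ σ) ⊗ 1`.

* `exists_equivariant_ringEquiv` — for the composite structure `K → B → C`, the chart `C'` IS `C ⊗_K K'`, by a ring isomorphism
  `e` with `e ((b ⊗ y) ⊗ c) = (b • c) ⊗ y`, `e ∘ (c ↦ 1 ⊗ c) = (c ↦ c ⊗ 1)`, `e (b' ⊗ 1) = (B → C) ⊗ 1 (b')`, and
  `e ∘ σ'' = (1_C ⊗ σ) ∘ e` (TWIST-EQUIVARIANT). So everything `…GaloisTwistInvariants` / `…GaloisFibre` prove for `B ⊗_K K'`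
  holds for the chart with `C` in place of `B`.
* **`exists_map_chartTwist_eq_of_comap_eq`** — `Gal(K'/K)` acts TRANSITIVELY, through the chart twists, on the primes of `C'` over a
  given prime of `C`: if `𝔚₁ ∩ C = 𝔚₂ ∩ C` then `𝔚₂ = σ''(𝔚₁)` for some `σ`.
* **`exists_decomposition_map_chartTwist_eq`** — if moreover `𝔚₁, 𝔚₂` lie over the same `𝔔' ⊆ B'`, that `σ` lies in the
  DECOMPOSITION GROUP of `𝔔'` (`(1 ⊗ σ) 𝔔' = 𝔔'`): the decomposition group acts transitively on the chart points over `(𝔔, 𝔔')`,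
  in particular on the trivial-residue points `𝔚` used by `…GaloisUpstairsPieceCover` / `…GaloisTwistStabilizer` (which it
  permutes, ✓ `…GaloisTwistChart.map_chartTwist_point`). With `…GaloisTwistStabilizer.map_twist_eq_self_of_map_chartTwist_eq` this
  says: the pieces descended through the various trivial-residue points over `𝔔'` are exactly the twists `(1 ⊗ τ) I₁`, `τ ∈ D`,
  of any one of them.
* `isMaximal_of_comap_includeRight_eq` — every prime of the chart over a maximal ideal of `C` is maximal.

Honest label: plumbing toward ONE leaf stub (no stub, crux or summit closed). No definitions, no named facts, no sorry.
[cite: StacksProject, Tag 09EB; Tag 0CDQ; Tag 00UW]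
-/

noncomputable section

-- single-problem summit: the doubled namespace component is forced
set_option linter.dupNamespace false

open scoped TensorProduct

namespace Summit.ResolutionOfSingularities.ResolutionOfSingularities.Theorems.FRationalResolution.GaloisChartTransitive

variable {K B K' C : Type} [Field K] [CommRing B] [Algebra K B] [Field K'] [Algebra K K'] [CommRing C] [Algebra B C]

/-- **The chart is `C ⊗_K K'`, equivariantly.** For `K → B → C` a tower, there is a ring isomorphism
`e : (B ⊗_K K') ⊗_B C ≃ C ⊗_K K'` with `e ((b ⊗ y) ⊗ c) = (b • c) ⊗ y`; it sends `1 ⊗ c ↦ c ⊗ 1`, `b' ⊗ 1 ↦ ((B → C) ⊗ 1) b'`,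
and intertwines the chart twist `σ'' = (1 ⊗ σ) ⊗ 1` with the twist `1_C ⊗ σ`. [cite: StacksProject, Tag 09EB] -/
theorem exists_equivariant_ringEquiv [Algebra K C] [IsScalarTower K B C] :
    ∃ e : ((B ⊗[K] K') ⊗[B] C) ≃+* (C ⊗[K] K'),
      (∀ (b : B) (y : K') (c : C), e ((b ⊗ₜ[K] y) ⊗ₜ[B] c) = (b • c) ⊗ₜ[K] y) ∧
      (∀ c : C, e ((Algebra.TensorProduct.includeRight : C →ₐ[B] (B ⊗[K] K') ⊗[B] C) c) = c ⊗ₜ[K] 1) ∧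
      (∀ b' : B ⊗[K] K', e (algebraMap (B ⊗[K] K') ((B ⊗[K] K') ⊗[B] C) b') =
        Algebra.TensorProduct.map (IsScalarTower.toAlgHom K B C) (AlgHom.id K K') b') ∧
      ∀ (σ : K' ≃ₐ[K] K') (x : (B ⊗[K] K') ⊗[B] C),
        e (Algebra.TensorProduct.map (Algebra.TensorProduct.map (AlgHom.id B B) (σ : K' →ₐ[K] K')) (AlgHom.id B C) x) =
          Algebra.TensorProduct.map (AlgHom.id C C) (σ : K' →ₐ[K] K') (e x) := by
  let Φ : ((B ⊗[K] K') ⊗[B] C) ≃ₐ[B] (C ⊗[K] K') :=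
    (Algebra.TensorProduct.comm B (B ⊗[K] K') C).trans (Algebra.TensorProduct.cancelBaseChange K B B C K')
  have hΦ : ∀ (b : B) (y : K') (c : C), Φ ((b ⊗ₜ[K] y) ⊗ₜ[B] c) = (b • c) ⊗ₜ[K] y := fun b y c => by
    simp only [Φ, AlgEquiv.trans_apply, Algebra.TensorProduct.comm_tmul, Algebra.TensorProduct.cancelBaseChange_tmul]
  have hΦ' : ∀ (b : B) (y : K') (c : C), Φ.toRingEquiv ((b ⊗ₜ[K] y) ⊗ₜ[B] c) = (b • c) ⊗ₜ[K] y := hΦ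
  refine ⟨Φ.toRingEquiv, hΦ', fun c => ?_, fun b' => ?_, fun σ x => ?_⟩
  · rw [Algebra.TensorProduct.includeRight_apply, Algebra.TensorProduct.one_def, hΦ', one_smul]
  · rw [Algebra.TensorProduct.algebraMap_apply, Algebra.algebraMap_self, RingHom.id_apply]
    induction b' using TensorProduct.induction_on with
    | zero => simp only [TensorProduct.zero_tmul, map_zero]
    | add u v hu hv => simp only [TensorProduct.add_tmul, map_add, hu, hv]
    | tmul b y =>
      rw [hΦ', Algebra.TensorProduct.map_tmul, AlgHom.id_apply, IsScalarTower.toAlgHom_apply,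
        Algebra.smul_def, mul_one]
  · induction x using TensorProduct.induction_on with
    | zero => simp only [map_zero]
    | add u v hu hv => simp only [map_add, hu, hv]
    | tmul b' c =>
      induction b' using TensorProduct.induction_on with
      | zero => simp only [TensorProduct.zero_tmul, map_zero]
      | add u v hu hv => simp only [TensorProduct.add_tmul, map_add, hu, hv]
      | tmul b y =>
        rw [GaloisTwistChart.chartTwist_tmul, Algebra.TensorProduct.map_tmul, AlgHom.id_apply, hΦ', hΦ',
          Algebra.TensorProduct.map_tmul, AlgHom.id_apply]

/-- **`Gal(K'/K)` acts transitively on the primes of the chart over a prime of `C`.** For `K'/K` finite Galois and primes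
`𝔚₁, 𝔚₂ ⊆ (B ⊗_K K') ⊗_B C` with the same contraction to `C`, some chart twist `σ'' = (1 ⊗ σ) ⊗ 1` carries `𝔚₁` onto `𝔚₂`.
(Transport of `…GaloisTwistInvariants.exists_map_twist_eq_of_comap_eq` for `C ⊗_K K'` along `exists_equivariant_ringEquiv`.)
[cite: StacksProject, Tag 09EB; Tag 0CDQ] -/
theorem exists_map_chartTwist_eq_of_comap_eq [FiniteDimensional K K'] [IsGalois K K']
    (𝔚₁ 𝔚₂ : Ideal ((B ⊗[K] K') ⊗[B] C)) [𝔚₁.IsPrime] [𝔚₂.IsPrime]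
    (h : 𝔚₁.comap ((Algebra.TensorProduct.includeRight : C →ₐ[B] (B ⊗[K] K') ⊗[B] C) : C →+* (B ⊗[K] K') ⊗[B] C) =
      𝔚₂.comap ((Algebra.TensorProduct.includeRight : C →ₐ[B] (B ⊗[K] K') ⊗[B] C) : C →+* (B ⊗[K] K') ⊗[B] C)) :
    ∃ σ : K' ≃ₐ[K] K',
      𝔚₂ = 𝔚₁.map (Algebra.TensorProduct.map (Algebra.TensorProduct.map (AlgHom.id B B) (σ : K' →ₐ[K] K'))
        (AlgHom.id B C)) := by
  letI : Algebra K C := ((algebraMap B C).comp (algebraMap K B)).toAlgebra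
  haveI : IsScalarTower K B C := IsScalarTower.of_algebraMap_eq fun _ => rfl
  obtain ⟨e, -, he, -, hσe⟩ := exists_equivariant_ringEquiv (K := K) (B := B) (K' := K') (C := C)
  -- the primes `e(𝔚ᵢ) = e.symm⁻¹(𝔚ᵢ)` of `C ⊗_K K'` contract to `𝔚ᵢ ∩ C`
  have hP : ∀ 𝔚 : Ideal ((B ⊗[K] K') ⊗[B] C),
      (𝔚.comap e.symm).comap (algebraMap C (C ⊗[K] K')) =
        𝔚.comap ((Algebra.TensorProduct.includeRight : C →ₐ[B] (B ⊗[K] K') ⊗[B] C) :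
          C →+* (B ⊗[K] K') ⊗[B] C) := by
    intro 𝔚
    ext c
    simp only [Ideal.mem_comap, RingHom.coe_coe]
    rw [Algebra.TensorProduct.algebraMap_apply, Algebra.algebraMap_self, RingHom.id_apply, ← he,
      RingEquiv.symm_apply_apply]
  obtain ⟨σ, hσ⟩ := GaloisTwistInvariants.exists_map_twist_eq_of_comap_eq (K := K) (K' := K') (B := C)
    (𝔚₁.comap e.symm) (𝔚₂.comap e.symm) (by rw [hP, hP, h])
  refine ⟨σ, ?_⟩
  rw [← GaloisTwistChart.comap_twist_inv_eq_map] at hσ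
  rw [← GaloisTwistChart.comap_chartTwist_inv_eq_map]
  ext x
  have hx : x ∈ 𝔚₂ ↔ e x ∈ 𝔚₂.comap e.symm := by
    rw [Ideal.mem_comap, RingEquiv.symm_apply_apply]
  rw [hx, hσ, Ideal.mem_comap, Ideal.mem_comap, Ideal.mem_comap, ← hσe, RingEquiv.symm_apply_apply]

/-- **The decomposition group acts transitively on the chart points over `(𝔔, 𝔔')`.** For `K'/K` finite Galois and primes
`𝔚₁, 𝔚₂` of the chart `(B ⊗_K K') ⊗_B C` lying over the same `𝔔' ⊆ B ⊗_K K'` and over the same prime of `C`, there is `σ` in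
the decomposition group of `𝔔'` (`(1 ⊗ σ) 𝔔' = 𝔔'`) with `σ''(𝔚₁) = 𝔚₂`. [cite: StacksProject, Tag 09EB; Tag 0CDQ] -/
theorem exists_decomposition_map_chartTwist_eq [FiniteDimensional K K'] [IsGalois K K'] (𝔔' : Ideal (B ⊗[K] K'))
    (𝔚₁ 𝔚₂ : Ideal ((B ⊗[K] K') ⊗[B] C)) [𝔚₁.IsPrime] [𝔚₂.IsPrime]
    (h₁ : 𝔚₁.comap (algebraMap (B ⊗[K] K') ((B ⊗[K] K') ⊗[B] C)) = 𝔔')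
    (h₂ : 𝔚₂.comap (algebraMap (B ⊗[K] K') ((B ⊗[K] K') ⊗[B] C)) = 𝔔')
    (h : 𝔚₁.comap ((Algebra.TensorProduct.includeRight : C →ₐ[B] (B ⊗[K] K') ⊗[B] C) : C →+* (B ⊗[K] K') ⊗[B] C) =
      𝔚₂.comap ((Algebra.TensorProduct.includeRight : C →ₐ[B] (B ⊗[K] K') ⊗[B] C) : C →+* (B ⊗[K] K') ⊗[B] C)) :
    ∃ σ : K' ≃ₐ[K] K',
      𝔔'.map (Algebra.TensorProduct.map (AlgHom.id B B) (σ : K' →ₐ[K] K')) = 𝔔' ∧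
      𝔚₂ = 𝔚₁.map (Algebra.TensorProduct.map (Algebra.TensorProduct.map (AlgHom.id B B) (σ : K' →ₐ[K] K'))
        (AlgHom.id B C)) := by
  obtain ⟨σ, hσ⟩ := exists_map_chartTwist_eq_of_comap_eq 𝔚₁ 𝔚₂ h
  refine ⟨σ, ?_, hσ⟩
  rw [← h₁, ← GaloisTwistChart.comap_algebraMap_map_chartTwist, ← hσ, h₂, h₁]

/-- Every prime of the chart `(B ⊗_K K') ⊗_B C` over a MAXIMAL ideal of `C` is maximal (`K'/K` finite, so the chart is integral
over `C`). [cite: StacksProject, Tag 00UW; Tag 09EB] -/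
theorem isMaximal_of_comap_includeRight_eq [FiniteDimensional K K'] (𝔔 : Ideal C) [h𝔔 : 𝔔.IsMaximal]
    (𝔚 : Ideal ((B ⊗[K] K') ⊗[B] C)) [𝔚.IsPrime]
    (h : 𝔚.comap ((Algebra.TensorProduct.includeRight : C →ₐ[B] (B ⊗[K] K') ⊗[B] C) : C →+* (B ⊗[K] K') ⊗[B] C) = 𝔔) :
    𝔚.IsMaximal := by
  letI : Algebra K C := ((algebraMap B C).comp (algebraMap K B)).toAlgebra
  haveI : IsScalarTower K B C := IsScalarTower.of_algebraMap_eq fun _ => rfl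
  obtain ⟨e, -, he, -, -⟩ := exists_equivariant_ringEquiv (K := K) (B := B) (K' := K') (C := C)
  have hP : (𝔚.comap e.symm).comap (algebraMap C (C ⊗[K] K')) = 𝔔 := by
    rw [← h]
    ext c
    simp only [Ideal.mem_comap, RingHom.coe_coe]
    rw [Algebra.TensorProduct.algebraMap_apply, Algebra.algebraMap_self, RingHom.id_apply, ← he,
      RingEquiv.symm_apply_apply]
  haveI : (𝔚.comap e.symm).IsMaximal := GaloisFibre.isMaximal_of_comap_eq (K := K) (K' := K') 𝔔 _ hP
  have : 𝔚 = (𝔚.comap e.symm).comap e := by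
    ext x
    rw [Ideal.mem_comap, Ideal.mem_comap, RingEquiv.symm_apply_apply]
  rw [this]
  exact Ideal.comap_isMaximal_of_surjective e e.surjective

end Summit.ResolutionOfSingularities.ResolutionOfSingularities.Theorems.FRationalResolution.GaloisChartTransitive

end
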